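import Mathlib

/-!
# FIFO slot calculus for wide all-X designs (support file for the refutation line of
# `BinomialElusive.PeelingLemma`, stmt-ValiantsHypothesis-7391)

Negative-lane helper (val-width-7391-ref-1, cdisprove).  The refutation of `PeelingLemma` is reduced
(p553410, p555890) to the existence of relation-free all-X designs; the candidate designs
(`Cruxes/PeelingLemma/ALLX-PROOF-SKETCH.md`, p1; refereed in `REFEREE-ref1.md`) carry along every
thread **FIFO vertex vectors**: the letter born at step `b` is `f b`, it is alive at the vertices
`b, b+1, …, b+2q` with alternating sign, i.e.

  `ψ_k = Σ_{j ≤ 2q} (-1)^j · e_{f (k - j)}`      (`fifoVec f q k`).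

This file is the bookkeeping every formalization of those designs starts from (all sorry-free):

* `fifoVec_apply_of_fresh` — under local freshness (stated inline) the coefficient of the letter `f b₀` in `ψ_k` is
  `(-1)^(k-b₀)` if `b₀ ≤ k ≤ b₀ + 2q` and `0` otherwise;
* `fifoVec_add_fifoVec_succ` — the DESIGN IDENTITY `ψ_k + ψ_{k+1} = e_{f (k-2q)} + e_{f (k+1)}`
  (consecutive vertex vectors sum to a pair vector: the dying letter and the newborn letter), which is
  what makes `Γ = z_k z_{k+1} - z_a z_b - z_c z_d` swallow to a binomial;
* `slot_coeff` — the SLOT FORMULA: the coefficient of `f b₀` in `Σ_{k∈S} c_k ψ_k` is the signed charge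
  sum over the lifetime window `[b₀, b₀+2q]` (REFEREE-ref1 §2; it replaces the prefix-sum count of the
  sketch's Lemma E2, which is only valid for windows of width `≤ 2q+1`);
* `charges_eq_zero_of_sum_fifoVec_eq_zero` — Lemma E1 of the sketch for every window width: if
  `Σ_{k∈S} c_k ψ_k = 0` then `c = 0` on `S` (downward induction on the youngest letter).

No declaration here asserts a Theses statement; Valiant's hypothesis is not touched.
-/

set_option linter.dupNamespace false

namespace Summit.ValiantsHypothesis.ValiantsHypothesis.Theorems.PeelingLemma.Negative.Fifo

open scoped BigOperators
open Finset

variable {Λ : Type*} [DecidableEq Λ]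

/-- The FIFO vertex vector at vertex `k` (letters `f (k-j)`, `j = 0..2q`, sign `(-1)^j`). -/
noncomputable def fifoVec (f : ℤ → Λ) (q : ℕ) (k : ℤ) : Λ → ℤ :=
  fun l => ∑ j ∈ Finset.range (2 * q + 1), if f (k - j) = l then (-1) ^ j else 0

/-- Coefficient of a locally fresh letter in a FIFO vertex vector.  *Local freshness* of the letter
`f b₀` seen from vertex `k`: no other birth time in the lifetime window ending at `k` carries the same
letter (`∀ j < 2q+1, f (k - j) = f b₀ → k - j = b₀`). -/
theorem fifoVec_apply_of_fresh (f : ℤ → Λ) (q : ℕ) (k b₀ : ℤ)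
    (h : ∀ j : ℕ, j < 2 * q + 1 → f (k - j) = f b₀ → k - j = b₀) :
    fifoVec f q k (f b₀) = if b₀ ≤ k ∧ k ≤ b₀ + 2 * q then (-1) ^ (k - b₀).toNat else 0 := by
  unfold fifoVec
  have hterm : ∀ j ∈ Finset.range (2 * q + 1),
      (if f (k - j) = f b₀ then (-1 : ℤ) ^ j else 0) =
        if j = (k - b₀).toNat ∧ (b₀ ≤ k ∧ k ≤ b₀ + 2 * q) then (-1) ^ (k - b₀).toNat else 0 := by
    intro j hj
    rw [Finset.mem_range] at hj
    by_cases hf : f (k - j) = f b₀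
    · have hkj : k - j = b₀ := h j hj hf
      have hj' : j = (k - b₀).toNat := by omega
      have hwin : b₀ ≤ k ∧ k ≤ b₀ + 2 * q := by constructor <;> omega
      rw [if_pos hf, if_pos ⟨hj', hwin⟩, ← hj']
    · rw [if_neg hf]
      by_cases hc : j = (k - b₀).toNat ∧ (b₀ ≤ k ∧ k ≤ b₀ + 2 * q)
      · exfalso; apply hf
        have : k - (j : ℤ) = b₀ := by obtain ⟨hj', hwin⟩ := hc; subst hj'; omega
        rw [this]
      · rw [if_neg hc]
  rw [Finset.sum_congr rfl hterm]
  by_cases hwin : b₀ ≤ k ∧ k ≤ b₀ + 2 * q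
  · simp only [hwin, and_true, Finset.sum_ite_eq', Finset.mem_range, if_true]
    have : (k - b₀).toNat < 2 * q + 1 := by omega
    rw [if_pos this]
  · simp only [hwin, and_false, if_false, Finset.sum_const_zero]

/-- **Design identity.**  Consecutive FIFO vectors sum to the pair vector of the dying and the
newborn letter: `ψ_k + ψ_{k+1} = e_{f(k-2q)} + e_{f(k+1)}` (no freshness needed). -/
theorem fifoVec_add_fifoVec_succ (f : ℤ → Λ) (q : ℕ) (k : ℤ) :
    fifoVec f q k + fifoVec f q (k + 1) =
      Pi.single (f (k - 2 * q)) 1 + Pi.single (f (k + 1)) 1 := by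
  funext l
  -- the summands of `ψ_k` and of `ψ_{k+1}` (the latter shifted by one) cancel pairwise
  set a : ℕ → ℤ := fun j => if f (k - j) = l then (-1) ^ j else 0 with ha
  set b : ℕ → ℤ := fun j => if f (k + 1 - j) = l then (-1) ^ j else 0 with hb
  have hA : fifoVec f q k l = (∑ j ∈ Finset.range (2 * q), a j) + a (2 * q) := by
    simp only [fifoVec, ha]; rw [Finset.sum_range_succ]
  have hB : fifoVec f q (k + 1) l = (∑ j ∈ Finset.range (2 * q), b (j + 1)) + b 0 := by
    simp only [fifoVec, hb]; rw [Finset.sum_range_succ']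
  have hC : ∀ j ∈ Finset.range (2 * q), a j + b (j + 1) = 0 := by
    intro j _
    simp only [ha, hb]
    have : (k + 1 - ((j + 1 : ℕ) : ℤ)) = k - j := by push_cast; ring
    rw [this]
    split_ifs <;> ring
  have hsum : (∑ j ∈ Finset.range (2 * q), a j) + ∑ j ∈ Finset.range (2 * q), b (j + 1) = 0 := by
    rw [← Finset.sum_add_distrib]; exact Finset.sum_eq_zero hC
  have ha2q : a (2 * q) = if f (k - 2 * (q : ℤ)) = l then 1 else 0 := by
    simp only [ha]; push_cast
    split_ifs <;> simp [pow_mul]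
  have hb0 : b 0 = if f (k + 1) = l then 1 else 0 := by
    simp only [hb]; simp
  rw [Pi.add_apply, hA, hB, Pi.add_apply, Pi.single_apply, Pi.single_apply]
  have hgoal : a (2 * q) + b 0 =
      (if l = f (k - 2 * (q : ℤ)) then (1 : ℤ) else 0) + (if l = f (k + 1) then 1 else 0) := by
    rw [ha2q, hb0]
    simp only [eq_comm (a := l)]
  linarith

/-- **Slot formula.**  For charges `c` on a finite vertex set `S`, the coefficient of a locally fresh
letter `f b₀` in `Σ_{k∈S} c_k ψ_k` is the signed charge sum over the lifetime window of that letter. -/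
theorem slot_coeff (f : ℤ → Λ) (q : ℕ) (S : Finset ℤ) (c : ℤ → ℤ) (b₀ : ℤ)
    (hfresh : ∀ k ∈ S, ∀ j : ℕ, j < 2 * q + 1 → f (k - j) = f b₀ → k - j = b₀) :
    (∑ k ∈ S, c k * fifoVec f q k (f b₀)) =
      ∑ k ∈ S.filter (fun k => b₀ ≤ k ∧ k ≤ b₀ + 2 * q), c k * (-1) ^ (k - b₀).toNat := by
  rw [Finset.sum_filter]
  refine Finset.sum_congr rfl (fun k hk => ?_)
  rw [fifoVec_apply_of_fresh f q k b₀ (hfresh k hk)]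
  split_ifs <;> simp

/-- **Lemma E1 (all widths).**  If the charged combination of FIFO vectors over `S` vanishes and the
letters born at the vertices of `S` are locally fresh, then all charges vanish. -/
theorem charges_eq_zero_of_sum_fifoVec_eq_zero (f : ℤ → Λ) (q : ℕ) (S : Finset ℤ) (c : ℤ → ℤ)
    (hfresh : ∀ k ∈ S, ∀ b₀ ∈ S, ∀ j : ℕ, j < 2 * q + 1 → f (k - j) = f b₀ → k - j = b₀)
    (hzero : ∀ l, ∑ k ∈ S, c k * fifoVec f q k l = 0) : ∀ k ∈ S, c k = 0 := by
  classical
  induction S using Finset.induction_on_max with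
  | empty => simp
  | insert k₀ S hlt ih =>
    -- the youngest letter `f k₀` is alive (within `insert k₀ S`) only at `k₀`
    have hk₀S : k₀ ∉ S := fun h => lt_irrefl _ (hlt k₀ h)
    have hfresh₀ : ∀ k ∈ insert k₀ S, ∀ j : ℕ, j < 2 * q + 1 → f (k - j) = f k₀ → k - j = k₀ :=
      fun k hk => hfresh k hk k₀ (Finset.mem_insert_self _ _)
    have hcoef := hzero (f k₀)
    rw [slot_coeff f q _ c k₀ hfresh₀] at hcoef
    have hfilter : (insert k₀ S).filter (fun k => k₀ ≤ k ∧ k ≤ k₀ + 2 * q) = {k₀} := by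
      ext k
      simp only [Finset.mem_filter, Finset.mem_insert, Finset.mem_singleton]
      constructor
      · rintro ⟨hk | hk, hle, -⟩
        · exact hk
        · exact absurd (hlt k hk) (not_lt.mpr hle)
      · intro hk; subst hk; exact ⟨Or.inl rfl, le_rfl, by omega⟩
    rw [hfilter, Finset.sum_singleton, sub_self, Int.toNat_zero, pow_zero, mul_one] at hcoef
    -- `c k₀ = 0`; remove `k₀` and apply the induction hypothesis
    have hS : ∀ k ∈ S, c k = 0 := by
      refine ih (fun k hk b₀ hb₀ => hfresh k (Finset.mem_insert_of_mem hk) b₀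
        (Finset.mem_insert_of_mem hb₀)) (fun l => ?_)
      have := hzero l
      rw [Finset.sum_insert hk₀S, hcoef, zero_mul, zero_add] at this
      exact this
    intro k hk
    rcases Finset.mem_insert.mp hk with rfl | hk
    · exact hcoef
    · exact hS k hk

end Summit.ValiantsHypothesis.ValiantsHypothesis.Theorems.PeelingLemma.Negative.Fifo
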